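import Literature.NumberTheory.GaloisRepresentations.FrobeniusDensity
import Literature.NumberTheory.GaloisRepresentations.ContinuousRep
import Literature.NumberTheory.Automorphic.ChebotarevArtinRepHolds
import Literature.RepresentationTheory.Semisimple.EquivOfCharacter
import HarnessLib

/-!
# Brauer–Taylor descent for `PotentialCompanionDescent.BrauerTaylorDescent` — Frobenius rigidity

Part 2b of the lineage programme (Barnet-Lamb–Gee–Geraghty–Taylor 2014, proof of Thm. 5.5.1):
the engine behind Mackey's isomorphism hypothesis `r_i^g|_{H_j ∩ g⁻¹H_ig} ≃ r_j|_{H_j ∩ g⁻¹H_ig}`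
of the virtual Brauer descent.  For an open subgroup `D ↪ Γ_K` (more generally an open embedding
`e : D → Γ_K` of topological groups) of the absolute Galois group of a number field `K`:

* `dense_setOf_isArithFrobAt` — the elements of `D` that are arithmetic Frobenii of `K` at primes
  above places outside a finite set `S` are dense in `D` (Chebotarev, via the tree's
  `absoluteGaloisGroup.frobenius_dense` and the proved `chebotarev_artinRep_holds`);
* `character_eq_of_eqOn_frobenius` — two representations of `D` with continuous characters
  (coefficients Hausdorff) whose characters agree at those Frobenii have equal characters;
* `nonempty_equiv_of_character_eqOn_frobenius` — hence, if both are finite-dimensional and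
  semisimple over a field of characteristic `0`, they are isomorphic (Brauer–Nesbitt,
  `Representation.nonempty_equiv_of_character_eq_of_isSemisimple`);
* `character_toRepresentation_comp`, `continuous_character_toRepresentation_comp`,
  `framedRep_trace_eq_of_charpoly_eq` — bookkeeping for framed representations `D → H →ₜ* GL_n(k)`.

References: Serre, *Abelian ℓ-adic representations* (1968), Ch. I §2.2 Cor. 2 and §2.3;
Barnet-Lamb–Gee–Geraghty–Taylor, Ann. of Math. 179 (2014), proof of Thm. 5.5.1.
-/

set_option linter.dupNamespace false

noncomputable section

open Field IsDedekindDomain NumberField Topology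
open Literature.NumberTheory.GaloisRepresentations Literature.NumberTheory.Automorphic
open Literature.RepresentationTheory.Semisimple

open scoped NumberField

namespace Summit.Langlands.Langlands.Theorems.BrauerTaylorDescent

universe u v w w'

section Density

variable {K : Type} [Field K] [NumberField K] {D : Type u} [TopologicalSpace D]

/-- **Frobenii are dense in an open subgroup.**  For an open embedding `e : D → Γ_K` (e.g. the
inclusion of an open subgroup, or of an open subgroup of an open subgroup) and a finite set `S`
of finite places of `K`, the elements `d ∈ D` such that `e d` is an arithmetic Frobenius at a prime
of `\bar ℤ_K` above a place `v ∉ S` are dense in `D`.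
Ref: Serre, *Abelian ℓ-adic representations*, Ch. I §2.2, Cor. 2 (a). [folklore] -/
theorem dense_setOf_isArithFrobAt (e : D → absoluteGaloisGroup K) (he : IsOpenEmbedding e)
    (S : Set (HeightOneSpectrum (𝓞 K))) (hS : S.Finite) :
    Dense {d : D | ∃ v ∉ S, ∃ 𝔓 ∈ v.primesAbove, IsArithFrobAt (𝓞 K) (e d) 𝔓} :=
  (absoluteGaloisGroup.frobenius_dense chebotarev_artinRep_holds K S hS).preimage he.isOpenMap

/-- The inclusion of an open subgroup of an open subgroup of `Γ_K` is an open embedding.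
[folklore] -/
theorem isOpenEmbedding_subgroup_subgroup {Γ : Type u} [Group Γ] [TopologicalSpace Γ]
    (H : Subgroup Γ) (hH : IsOpen (H : Set Γ)) (D : Subgroup H) (hD : IsOpen (D : Set H)) :
    IsOpenEmbedding fun d : D => ((d : H) : Γ) :=
  (hH.isOpenEmbedding_subtypeVal).comp hD.isOpenEmbedding_subtypeVal

end Density

section Rigidity

variable {K : Type} [Field K] [NumberField K] {D : Type u} [Group D] [TopologicalSpace D]
  {k : Type v} [Field k] [TopologicalSpace k] [T2Space k]
  {V₁ : Type w} [AddCommGroup V₁] [Module k V₁] {V₂ : Type w'} [AddCommGroup V₂] [Module k V₂]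

/-- **Rigidity of characters.**  Two representations of `D` (openly embedded in `Γ_K` by `e`)
with continuous characters, agreeing at the Frobenii of `K` outside a finite set `S` of places,
have the same character. [folklore] -/
theorem character_eq_of_eqOn_frobenius (e : D → absoluteGaloisGroup K) (he : IsOpenEmbedding e)
    (S : Set (HeightOneSpectrum (𝓞 K))) (hS : S.Finite)
    (r₁ : Representation k D V₁) (r₂ : Representation k D V₂)
    (h₁ : Continuous r₁.character) (h₂ : Continuous r₂.character)
    (h : ∀ d : D, (∃ v ∉ S, ∃ 𝔓 ∈ v.primesAbove, IsArithFrobAt (𝓞 K) (e d) 𝔓) →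
      r₁.character d = r₂.character d) :
    r₁.character = r₂.character :=
  Continuous.ext_on (dense_setOf_isArithFrobAt e he S hS) h₁ h₂ fun d hd => h d hd

variable [CharZero k] [FiniteDimensional k V₁] [FiniteDimensional k V₂]

/-- **Frobenius rigidity (Chebotarev + Brauer–Nesbitt).**  Two finite-dimensional semisimple
representations of `D ↪ Γ_K` over a Hausdorff field of characteristic `0`, with continuous
characters agreeing at the Frobenii of `K` outside a finite set of places, are isomorphic.
Ref: Serre, *Abelian ℓ-adic representations*, Ch. I §2.3; BLGGT 2014, proof of Thm. 5.5.1.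
[folklore] -/
theorem nonempty_equiv_of_character_eqOn_frobenius (e : D → absoluteGaloisGroup K)
    (he : IsOpenEmbedding e) (S : Set (HeightOneSpectrum (𝓞 K))) (hS : S.Finite)
    (r₁ : Representation k D V₁) (r₂ : Representation k D V₂)
    [r₁.IsSemisimpleRepresentation] [r₂.IsSemisimpleRepresentation]
    (h₁ : Continuous r₁.character) (h₂ : Continuous r₂.character)
    (h : ∀ d : D, (∃ v ∉ S, ∃ 𝔓 ∈ v.primesAbove, IsArithFrobAt (𝓞 K) (e d) 𝔓) →
      r₁.character d = r₂.character d) :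
    Nonempty (r₁.Equiv r₂) :=
  Representation.nonempty_equiv_of_character_eq_of_isSemisimple r₁ r₂
    (character_eq_of_eqOn_frobenius e he S hS r₁ r₂ h₁ h₂ h)

end Rigidity

/-! ### Bookkeeping for framed representations -/

section Framed

variable {H : Type u} [Group H] [TopologicalSpace H] {D : Type w} [Group D] [TopologicalSpace D]
  {k : Type v} [Field k] [TopologicalSpace k] [IsTopologicalRing k] {n : ℕ}

omit [TopologicalSpace D] [IsTopologicalRing k] in
/-- The character of `kⁿ` with `D` acting through `D → H →ₜ* GL_n(k)` is the matrix trace.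
[folklore] -/
theorem character_toRepresentation_comp (r : FramedRep H k n) (f : D →* H) (d : D) :
    Representation.character (r.toRepresentation.comp f) d = FramedRep.trace r (f d) := by
  change LinearMap.trace k _ (r.toRepresentation (f d)) = _
  have : (r.toRepresentation (f d) : (Fin n → k) →ₗ[k] (Fin n → k)) =
      Matrix.toLin' ((r (f d) : GL (Fin n) k) : Matrix (Fin n) (Fin n) k) := by
    apply LinearMap.ext
    intro x
    rfl
  rw [this, Matrix.trace_toLin'_eq]
  rfl

/-- … hence is continuous when `D → H` is. [folklore] -/
theorem continuous_character_toRepresentation_comp (r : FramedRep H k n) (f : D →* H)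
    (hf : Continuous f) : Continuous (Representation.character (r.toRepresentation.comp f)) := by
  have : Representation.character (r.toRepresentation.comp f) = fun d => FramedRep.trace r (f d) :=
    funext (character_toRepresentation_comp r f)
  rw [this]
  exact r.continuous_trace.comp hf

omit [TopologicalSpace k] [IsTopologicalRing k] in
/-- Equal characteristic polynomials have equal traces. [folklore] -/
theorem matrix_trace_eq_of_charpoly_eq {M N : Matrix (Fin n) (Fin n) k} (h : M.charpoly = N.charpoly) :
    M.trace = N.trace := by
  rcases Nat.eq_zero_or_pos n with hn | hn
  · subst hn
    simp [Matrix.trace]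
  · haveI : Nonempty (Fin n) := ⟨⟨0, hn⟩⟩
    rw [Matrix.trace_eq_neg_charpoly_coeff, Matrix.trace_eq_neg_charpoly_coeff, h]

omit [IsTopologicalRing k] in
/-- For framed representations: equal Frobenius characteristic polynomials give equal traces.
[folklore] -/
theorem framedRep_trace_eq_of_charpoly_eq {H' : Type w} [Group H'] [TopologicalSpace H']
    (r : FramedRep H k n) (r' : FramedRep H' k n) {x : H} {y : H'}
    (h : FramedRep.charpoly r x = FramedRep.charpoly r' y) :
    FramedRep.trace r x = FramedRep.trace r' y :=
  matrix_trace_eq_of_charpoly_eq h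

end Framed

end Summit.Langlands.Langlands.Theorems.BrauerTaylorDescent

end
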